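import Summits.BirchSwinnertonDyer.BirchSwinnertonDyer.Theorems.RamifiedSevenEllipticUnitsRubinPackageOfRigidity
import Summits.BirchSwinnertonDyer.BirchSwinnertonDyer.Theorems.RamifiedSevenEllipticUnitsRelativeValuationOfPackage
import Summits.BirchSwinnertonDyer.BirchSwinnertonDyer.Theorems.RamifiedSevenEllipticUnitsPinnedCharacterRigiditySeven
import Summits.BirchSwinnertonDyer.Rank1Residual.X12.O11.RamifiedRelativeValuationLineZp
import Summits.BirchSwinnertonDyer.BirchSwinnertonDyer.Theorems.RamifiedSevenEllipticUnitsQuadraticRamificationAwayOfTwist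
import Summits.BirchSwinnertonDyer.BirchSwinnertonDyer.Theorems.RamifiedSevenEllipticUnitsOddPowerUnramifiedLocal
import HarnessLib

set_option linter.dupNamespace false
set_option autoImplicit false

/-!
# K7r crux `EllipticUnitValueSevenOfGZK` (stmt-BirchSwinnertonDyer-19945), line `rubin-formula-zp` v4.4 —
# THE RUBIN PACKAGE WITHOUT UNIT VALUES: `S_pkg ⟸ {S_pkg⁻, Hecke-FE, Deuring-with-GENERATORS, H_Rig⁰}`
# (cell `bsd-cm`, seat `bsd-cm-k7r-c2` g13, FILE 3; helper `--supports` 19945; THEOREMS ONLY, nothing asserted)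

HONEST FRAMING. The registered skeleton v4.4 (`78d3f8f5baabbaa8`, line owner k7r-c4) derives S_pkg
(`X12.O11.RamifiedCMRubinPackageAtZp W 7 D₀`) through `RubinPackageOfRigidity.rubinPackage_of_facts_of_rigidity_of_reduced`
from S_pkg⁻, Hecke's functional equation, Deuring-with-generators, H_Rig⁰ AND H_QR — and H_QR's `𝔭`-square
clause is where the stronger print fact `Deuring_exists_heckeCharacter_of_maximalCM_withUnitValues` (clause
(vii), Silverman ATAEC II 9.1 (i)) enters the line. THIS FILE re-assembles S_pkg WITHOUT H_QR: clause (P3)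
(«the interpolated character `φ^{2·7^m+1}` is ramified at `𝔭` and at every ramified place of `φ`») is
supplied AT `𝔭` by FILE 2 (`OddPowerLocal.isUnramifiedAt_of_pow_of_coprime`: order of `φ_𝔭|𝒪_𝔭ˣ` divides
`2·7^f` for an EQUIVARIANT `φ`; `φ` ramified at `𝔭` by k7r-c3 g13's pinning lemma) and AWAY from `𝔭` by
FILE 1 (`TwistTransport.sq_isUnramifiedAt_of_pinned_of_seven_notMem`: `φ²` unramified at every `w ∌ 7` by
twist transport from PLAIN Deuring). Everything else ((P1)/(P5) LEMMA Ξ on the Deuring shape, (P2) from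
Hecke's FE, the telescope) is k7r-c4's assembly VERBATIM. CONSEQUENCE (route-independent kernel records, NOT a registration):
`S_pkg` and the fit witness `S_open = RamifiedCMRubinFormulaAtZp W 7` at every member of 𝒞₇ from Hecke-FE,
Deuring-with-GENERATORS (the W50 fact `…withGenerators`), S_pkg⁻ and S_arch — Silverman II 9.1 (i) (unit values,
clause (vii) of `…withUnitValues`) is consumed NOWHERE; the crux-level one-liner follows by
`RubinFormulaZpIffValue.valueSevenOfGZK_of_rubinFormulaSevenZp` (sequel record file). A re-registration (v4.5)
is the planner's / line owner's pen; nothing is registered here. CONDITIONAL; BSD is not proved for any curve;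
19945 stays OPEN.

* §1 `RubinPackageOfTwist.smul_eq_of_seven_mem`, `…absNorm_eq_seven` (the prime above the ramified 7);
* §2 `RubinPackageOfTwist.interpolated_not_isUnramifiedAt` — clause (P3) for an equivariant pinned `φ` in
  the position `φ ∈ {ψ, ψ∘c}` of a structured pinned `ψ`, from FILE 1 + FILE 2;
* §3 **`RubinPackageOfTwist.rubinPackage_of_hecke_of_deuringGenerators_of_rigidity_of_reduced`** (no H_QR);
* §4 𝒞₇ forms (S_pkg, S_open).

References: [BurungaleKobayashiNakamuraOta2026] Def. 4.7, Thm. 4.12, §4.1 (shape only); [SilvermanATAEC1994]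
II 9.2, 10.4, 10.5; [deShalit1987] II.1.1; [NeukirchANT1999] I (8.2), (9.6), VII (6.10); cell texts STATUS
2026-08-27 D184/D188/D189/D196, k7r-c2 g13 11:08Z.
-/

noncomputable section

open scoped Classical ComplexConjugate

open WeierstrassCurve NumberField IsDedekindDomain Field PowerSeries
  Literature.NumberTheory.EllipticCurves
  Literature.NumberTheory.EllipticCurves.Rank1Residual
  Literature.NumberTheory.EllipticCurves.Rank1Residual.Typed
  Literature.NumberTheory.EllipticCurves.Castella2018
  Literature.NumberTheory.EllipticCurves.BurungaleKobayashiNakamuraOta2026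
  Literature.NumberTheory.GaloisRepresentations
  Literature.NumberTheory.DiophantineGeometry
  Summit.BirchSwinnertonDyer.Rank1Residual.Additive

namespace Summit.BirchSwinnertonDyer.BirchSwinnertonDyer.Theorems.RamifiedSevenEllipticUnits

namespace RubinPackageOfTwist

open Summit.BirchSwinnertonDyer.Rank1Residual Summit.BirchSwinnertonDyer.Rank1Residual.X12
  Summit.BirchSwinnertonDyer.Rank1Residual.X12.O11 RubinPackageOfReduced RubinPackageOfRigidity

/-! ## §1 The prime above the ramified `7` -/

section FramePrime

variable {K : Type} [Field K] [NumberField K] {𝔭 : HeightOneSpectrum (𝓞 K)}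

/-- **Every `c ∈ Gal(K/ℚ)` fixes the prime above `7`** in a quadratic field with `d_K = −7` (`𝔭` is the
only prime containing `7`, and `c • 𝔭 ∋ c(7) = 7`). [cite: NeukirchANT1999, Ch. I §9 Prop. (9.6)] -/
theorem smul_eq_of_seven_mem [Fact (Nat.Prime 7)] (h2 : Module.finrank ℚ K = 2)
    (hdK : NumberField.discr K = -7) (h7 : ((7 : ℕ) : 𝓞 K) ∈ 𝔭.asIdeal) (c : K ≃ₐ[ℚ] K) : c • 𝔭 = 𝔭 := by
  have hgen : Rat.HeightOneSpectrum.natGenerator (𝔭.under (𝓞 ℚ)) = 7 :=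
    natGenerator_under_eq_of_natCast_mem 𝔭 (by norm_num) h7
  have h7c : ((7 : ℕ) : 𝓞 K) ∈ (c • 𝔭).asIdeal := by
    have h := (ModularForms.asIdeal_under_eq_iff_natCast_mem (𝔭.under (𝓞 ℚ)) (c • 𝔭)).mp
      (by rw [Rigidity.under_smul_asIdeal]; rfl)
    rwa [hgen] at h
  exact HeightOneSpectrum.ext
    (LemmaXi.eq_asIdeal_of_dvd_discr h2 (by rw [hdK]; norm_num) 𝔭 h7 h7c)

/-- **`N𝔭 = 7`** for the prime above `7` in a quadratic field with `d_K = −7` (`7𝓞_K = 𝔭²`).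
[cite: NeukirchANT1999, Ch. I §8 Prop. (8.2)] -/
theorem absNorm_eq_seven [Fact (Nat.Prime 7)] (h2 : Module.finrank ℚ K = 2)
    (hdK : NumberField.discr K = -7) (h7 : ((7 : ℕ) : 𝓞 K) ∈ 𝔭.asIdeal) : Ideal.absNorm 𝔭.asIdeal = 7 := by
  have hdvd : ((7 : ℕ) : ℤ) ∣ NumberField.discr K := by rw [hdK]; norm_num
  have hsq := congrArg Ideal.absNorm (LemmaXi.span_natCast_eq_sq_of_dvd_discr h2 hdvd 𝔭 h7)
  rw [Ideal.absNorm_span_natCast, NumberField.RingOfIntegers.rank, h2, map_pow] at hsq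
  exact (Nat.pow_left_injective two_ne_zero hsq).symm

/-- A place containing `7` IS `𝔭`. [cite: NeukirchANT1999, Ch. I §9 Prop. (9.6)] -/
theorem eq_of_seven_mem [Fact (Nat.Prime 7)] (h2 : Module.finrank ℚ K = 2) (hdK : NumberField.discr K = -7)
    (h7 : ((7 : ℕ) : 𝓞 K) ∈ 𝔭.asIdeal) {w : HeightOneSpectrum (𝓞 K)} (hw : ((7 : ℕ) : 𝓞 K) ∈ w.asIdeal) :
    w = 𝔭 :=
  HeightOneSpectrum.ext (LemmaXi.eq_asIdeal_of_dvd_discr h2 (by rw [hdK]; norm_num) 𝔭 h7 hw)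

end FramePrime

/-! ## §2 Clause (P3) for an equivariant pinned character, from FILE 1 (away) and FILE 2 (at `𝔭`) -/

section P3

variable {K : Type} [Field K] [NumberField K] {𝔭 : HeightOneSpectrum (𝓞 K)}

/-- **(P3) AT `𝔭`, UV-free**: for `K` imaginary quadratic with `d_K = −7`, `𝔭 ∋ 7`, a curve `V/ℚ` with CM
and CM field `ℚ(√−7)`, and `φ` a `c`-EQUIVARIANT Hecke character pinned to `V`: `φ^M` is ramified at `𝔭` for
every `M` coprime to `14` (`φ` ramified at `𝔭` by the pinning, k7r-c3 g13; FILE 2). No print fact.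
[cite: SilvermanAEC2009, App. C §16 (a₇ = 0 at an additive prime)] [cite: NeukirchANT1999, Ch. VII §6 (6.10)] -/
theorem not_isUnramifiedAt_pow_of_coprime_of_pinned [Fact (Nat.Prime 7)] (hK : IsImaginaryQuadratic K)
    (hdK : NumberField.discr K = -7) (h7 : ((7 : ℕ) : 𝓞 K) ∈ 𝔭.asIdeal)
    (V : WeierstrassCurve ℚ) [V.IsElliptic] (hV : V.HasCM) (hV7 : cmFieldDiscrOfJ V.j = -7)
    {c : K ≃ₐ[ℚ] K} {φ : HeckeCharacter K} (heq : IsHeckeConjEquivariant c φ)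
    (hpin : ∀ s : ℂ, 3 / 2 < s.re → heckeLFunction φ s = V.LSeries s) {M : ℕ} (hM : M.Coprime 14) :
    ¬ (φ ^ M).IsUnramifiedAt 𝔭 := fun h ↦
  QuadraticRamification.not_isUnramifiedAt_of_cmFieldDiscr_eq_neg_seven hV hV7 hK.1 hdK h7 φ hpin
    (OddPowerLocal.isUnramifiedAt_of_pow_of_coprime 𝔭 heq (smul_eq_of_seven_mem hK.1 hdK h7 c) h7
      (absNorm_eq_seven hK.1 hdK h7) hM h)

/-- `gcd(2·7^m + 1, 14) = 1`. [folklore] -/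
theorem coprime_two_mul_seven_pow_add_one (m : ℕ) : (2 * 7 ^ m + 1).Coprime 14 := by
  have h2 : Nat.Coprime (2 * 7 ^ m + 1) 2 := by
    rw [Nat.coprime_two_right]
    exact ⟨7 ^ m, by ring⟩
  have h7 : Nat.Coprime (2 * 7 ^ m + 1) 7 := by
    rcases Nat.eq_zero_or_pos m with rfl | hm
    · decide
    · rw [Nat.coprime_comm, Nat.Prime.coprime_iff_not_dvd (by norm_num)]
      intro h
      have h7m : 7 ∣ 2 * 7 ^ m := Dvd.dvd.mul_left (dvd_pow_self 7 hm.ne') 2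
      have := (Nat.dvd_add_right h7m).mp h
      omega
  have h14 : (14 : ℕ) = 2 * 7 := by norm_num
  rw [h14]
  exact Nat.Coprime.mul_right h2 h7

/-- **CLAUSE (P3) WITHOUT UNIT VALUES.** `K` imaginary quadratic with `d_K = −7`, `𝔭 ∋ 7`, `c ≠ 1`; `V/ℚ`
with CM field `ℚ(√−7)`; `ψ` of type `(1,0)`, `c`-equivariant, pinned to `V`; `φ ∈ {ψ, ψ∘c}` pinned to `V`;
`ξ₁ = φ(φ∘c)⁻¹` (clause (P1)). Then for every `w` with `w = 𝔭` or `φ` ramified at `w`, the interpolated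
character `φ^{7^m+1}(φ∘c)^{7^m}ξ₁^{7^m}·𝟙 = φ^{2·7^m+1}` is RAMIFIED at `w`: at `𝔭` by
`not_isUnramifiedAt_pow_of_coprime_of_pinned` (`φ` is `c`-equivariant in both positions), at `w ∌ 7` because
`φ²` is unramified there (FILE 1, PLAIN Deuring, transported along `galConj` in the position `ψ∘c`).
CONDITIONAL on `Deuring_exists_heckeCharacter_of_maximalCM` only.
[cite: BurungaleKobayashiNakamuraOta2026, Def. 4.2 ff. and §4.1 (arXiv:2608.06879 pp. 25–26) (`ξ₁`, the interpolated character; shape only)]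
[cite: SilvermanATAEC1994, Ch. II Thm. 9.2 and Thm. 10.5 (shape only)] -/
theorem interpolated_not_isUnramifiedAt [Fact (Nat.Prime 7)] (hDe : Deuring_exists_heckeCharacter_of_maximalCM)
    (hK : IsImaginaryQuadratic K) (hdK : NumberField.discr K = -7) (h7 : ((7 : ℕ) : 𝓞 K) ∈ 𝔭.asIdeal)
    (c : K ≃ₐ[ℚ] K) (hc : c ≠ 1)
    (V : WeierstrassCurve ℚ) [V.IsElliptic] (hV : V.HasCM) (hV7 : cmFieldDiscrOfJ V.j = -7)
    (ψ : HeckeCharacter K) (hinf : ψ.HasInfinityType (fun _ ↦ 1) (fun _ ↦ 0)) (heq : IsHeckeConjEquivariant c ψ)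
    (hψ : ∀ s : ℂ, 3 / 2 < s.re → heckeLFunction ψ s = V.LSeries s)
    {φ : HeckeCharacter K} (hφcase : φ = ψ ∨ φ = HeckeCharacter.galConj c ψ)
    (hφ : ∀ s : ℂ, 3 / 2 < s.re → heckeLFunction φ s = V.LSeries s)
    {ξ₁ : HeckeCharacter K} (hξ : ξ₁ = φ * (HeckeCharacter.galConj c φ)⁻¹) (m : ℕ) :
    ∀ w, (w = 𝔭 ∨ ¬ φ.IsUnramifiedAt w) →
      ¬ (φ ^ (7 ^ m + 1) * HeckeCharacter.galConj c φ ^ 7 ^ m * ξ₁ ^ 7 ^ m * 1).IsUnramifiedAt w := by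
  have heqφ : IsHeckeConjEquivariant c φ := by
    rcases hφcase with h | h
    · exact h ▸ heq
    · exact h ▸ isHeckeConjEquivariant_galConj hK.1 heq
  -- `ψ²` unramified at every `w ∌ 7` (FILE 1), transported to `φ`
  have hsqψ : ∀ w : HeightOneSpectrum (𝓞 K), ((7 : ℕ) : 𝓞 K) ∉ w.asIdeal → (ψ ^ 2).IsUnramifiedAt w :=
    fun w hw ↦ TwistTransport.sq_isUnramifiedAt_of_pinned_of_seven_notMem hDe hK hdK c hc V hV hV7 ψ hinf hψ w hw
  have hsqφ : ∀ w : HeightOneSpectrum (𝓞 K), ((7 : ℕ) : 𝓞 K) ∉ w.asIdeal → (φ ^ 2).IsUnramifiedAt w := by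
    intro w hw
    rcases hφcase with h | h
    · rw [h]; exact hsqψ w hw
    · rw [h, QuadraticRamification.galConj_sq, HeckeCharacter.isUnramifiedAt_galConj_iff]
      refine hsqψ (c • w) fun h7c ↦ hw ?_
      -- `7 ∈ c • w ⇒ c • w = 𝔭 ⇒ w = c⁻¹-translate… simpler: 7 ∈ c • w ⇒ 7 ∈ w` (the place under is the same)
      have hgen := natGenerator_under_eq_of_natCast_mem (c • w) (by norm_num : (7 : ℕ).Prime) h7c
      have hcw : (c • w).under (𝓞 ℚ) = w.under (𝓞 ℚ) :=
        HeightOneSpectrum.ext (by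
          rw [HeightOneSpectrum.under_asIdeal, HeightOneSpectrum.under_asIdeal]
          exact Rigidity.under_smul_asIdeal c w)
      rw [hcw] at hgen
      rw [← hgen]
      exact (ModularForms.asIdeal_under_eq_iff_natCast_mem (w.under (𝓞 ℚ)) w).mp rfl
  intro w hw
  rw [RelativeValuationOfDatum.interpolatedCharacter_eq_pow hξ (7 ^ m)]
  by_cases hw7 : ((7 : ℕ) : 𝓞 K) ∈ w.asIdeal
  · -- `w = 𝔭`
    rw [eq_of_seven_mem hK.1 hdK h7 hw7]
    exact not_isUnramifiedAt_pow_of_coprime_of_pinned hK hdK h7 V hV hV7 heqφ hφ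
      (coprime_two_mul_seven_pow_add_one m)
  · -- `w ∌ 7`: `φ` ramified at `w` (as `w ≠ 𝔭`) and `φ²` unramified at `w`
    have hram : ¬ φ.IsUnramifiedAt w := by
      rcases hw with rfl | h
      · exact absurd h7 hw7
      · exact h
    exact LemmaXi.not_isUnramifiedAt_pow_odd (hsqφ w hw7) hram (7 ^ m)

end P3

/-! ## §3 THE ASSEMBLY WITHOUT H_QR: `S_pkg ⟸ {S_pkg⁻, Hecke-FE, Deuring-G, H_Rig⁰}` -/

section Assembly

variable {W : WeierstrassCurve ℚ} [W.IsElliptic] [W.IsGloballyMinimal] {D₀ : ℤ}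

omit [W.IsGloballyMinimal] in
/-- **`S_pkg` FROM THE REDUCED PACKAGE, HECKE'S FUNCTIONAL EQUATION, DEURING-WITH-GENERATORS AND PURE RIGIDITY —
NO H_QR, NO UNIT VALUES, NO GROSS.** Verbatim k7r-c4's `rubinPackage_of_facts_of_rigidity_of_reduced` (p509934)
except that clause (P3) is supplied by `interpolated_not_isUnramifiedAt` (FILE 1 + FILE 2) instead of H_QR; the
plain Deuring fact needed by FILE 1 is the generators fact with clause (vi) forgotten
(`Deuring_exists_heckeCharacter_of_maximalCM_of_withGenerators`). CONDITIONAL; nothing booked.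
[cite: BurungaleKobayashiNakamuraOta2026, Def. 4.7 and Thm. 4.12 (arXiv:2608.06879 pp. 27, 32; claim; preprint; shape only)]
[cite: SilvermanATAEC1994, Ch. II Thm. 9.2, Cor. 10.4.1 (a), Thm. 10.5 (b)] [cite: deShalit1987, II.1.1 (1)–(3)] -/
theorem rubinPackage_of_hecke_of_deuringGenerators_of_rigidity_of_reduced [Fact (Nat.Prime 7)]
    (hj : cmFieldDiscrOfJ W.j = -7) (hD₀ : D₀ ≠ 0)
    (hHecke : Hecke_functionalEquation_infinityType)
    (hD : Deuring_exists_heckeCharacter_of_maximalCM_withGenerators)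
    (hrig : RamifiedCMPinnedCharacterRigidityAtZp W 7)
    (hred : RamifiedCMRubinPackageReducedAtZp W 7 D₀) :
    RamifiedCMRubinPackageAtZp W 7 D₀ := by
  intro K _ _ 𝔭 W' _ _ C hF hr κ hκ γ _ P n P' n' hP hgen htors hdiv hndiv hP' hgen' htors' hdiv' hndiv'
    q q' hq hq' ι φ Ω 𝓔 D c hΩ hφ hc himc l hl W₀ _ _ hW₀ φ₀ hφ₀ m r hcont hcont₀ hρ hr0 hlt
  obtain ⟨cK, hcK, R, Ω₀, 𝓔₀, D₀', R₀, hΩ₀, hbase, hper, hbottom⟩ :=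
    hred K 𝔭 W' C hF hr κ hκ γ P n P' n' hP hgen htors hdiv hndiv hP' hgen' htors' hdiv' hndiv' q q' hq hq'
      ι φ Ω 𝓔 D c hΩ hφ hc himc l hl W₀ hW₀ φ₀ hφ₀ m r hcont hcont₀ hρ hr0 hlt
  -- the frame: `K = ℚ(√−7)`, `7 ∈ 𝔭`; the member and the base model are CM with field `ℚ(√−7)`
  have hK : IsImaginaryQuadratic K := hF.2.2.2.1
  have h2 : Module.finrank ℚ K = 2 := hK.1
  have hdK : NumberField.discr K = -7 := by
    have h := hF.2.2.2.2.1
    rw [hj] at h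
    exact h
  have hdK' : NumberField.discr K = -((7 : ℕ) : ℤ) := by rw [hdK]; norm_num
  have h7 : ((7 : ℕ) : 𝓞 K) ∈ 𝔭.asIdeal := by simpa using hF.2.2.2.2.2.1
  have hnr : ∀ σ' : K →+* ℂ, ¬ ComplexEmbedding.IsReal σ' :=
    (LemmaXi.frame_fieldInputs (K := K) (p := 7) hK hdK' (by norm_num)).2.2.2.2.1
  have hWcm : W.HasCM := hF.1
  have hW₀cm : W₀.HasCM := RouteU.hasCM_of_twist_cm7 W₀ hD₀ hW₀
  have hW₀j' : cmFieldDiscrOfJ W₀.j = -7 := RouteU.cmFieldDiscrOfJ_of_twist_cm7 W₀ hD₀ hW₀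
  have hW₀j : cmFieldDiscrOfJ W₀.j = cmFieldDiscrOfJ W.j := by rw [hW₀j', hj]
  have hDe : Deuring_exists_heckeCharacter_of_maximalCM :=
    Deuring_exists_heckeCharacter_of_maximalCM_of_withGenerators hD
  -- §1: Deuring characters with values; H_Rig⁰: the position of `φ`, `φ₀`
  obtain ⟨ψ, hinf, heq, hψ, σ, hσ⟩ := exists_deuringCharacter_of_cmFieldDiscr hD hWcm hj hK hdK cK hcK
  obtain ⟨ψ₀, hinf₀, heq₀, hψ₀, σ₀, hσ₀⟩ :=
    exists_deuringCharacter_of_cmFieldDiscr hD hW₀cm hW₀j' hK hdK cK hcK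
  have hφcase : φ = ψ ∨ φ = HeckeCharacter.galConj cK ψ :=
    hrig K 𝔭 W' C hF W hWcm rfl cK hcK ψ φ hinf heq hψ hφ
  have hφ₀case : φ₀ = ψ₀ ∨ φ₀ = HeckeCharacter.galConj cK ψ₀ :=
    hrig K 𝔭 W' C hF W₀ hW₀cm hW₀j cK hcK ψ₀ φ₀ hinf₀ heq₀ hψ₀ hφ₀
  -- (P1)/(P5) for `R` and `R₀` from the Deuring shape (k7r-c2's frame theorem), both orientations
  have hP15 : R.ξ = φ * (HeckeCharacter.galConj cK φ)⁻¹ ∧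
      ‖avatarValueAt R.r γ - 1‖ ^ 2 = (((7 : ℕ) : ℝ))⁻¹ := by
    rcases hφcase with h | h
    · subst h
      exact RubinPadicLFunctionData.ξ_eq_φac_and_norm_sq_of_frame R hK hdK' (by norm_num) h7 hcK σ heq
        (deuringShape_of_values hσ)
    · subst h
      exact RubinPadicLFunctionData.ξ_eq_φac_and_norm_sq_of_frame R hK hdK' (by norm_num) h7 hcK
        (σ.comp (cK : K →+* K)) (isHeckeConjEquivariant_galConj h2 heq)
        (deuringShape_of_values (deuringValues_galConj h2 hcK heq σ (hnr σ) hσ))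
  have hP15₀ : R₀.ξ = φ₀ * (HeckeCharacter.galConj cK φ₀)⁻¹ ∧
      ‖avatarValueAt R₀.r γ - 1‖ ^ 2 = (((7 : ℕ) : ℝ))⁻¹ := by
    rcases hφ₀case with h | h
    · subst h
      exact RubinPadicLFunctionData.ξ_eq_φac_and_norm_sq_of_frame R₀ hK hdK' (by norm_num) h7 hcK σ₀ heq₀
        (deuringShape_of_values hσ₀)
    · subst h
      exact RubinPadicLFunctionData.ξ_eq_φac_and_norm_sq_of_frame R₀ hK hdK' (by norm_num) h7 hcK
        (σ₀.comp (cK : K →+* K)) (isHeckeConjEquivariant_galConj h2 heq₀)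
        (deuringShape_of_values (deuringValues_galConj h2 hcK heq₀ σ₀ (hnr σ₀) hσ₀))
  obtain ⟨hξ, hu⟩ := hP15
  obtain ⟨hξ₀, hu₀⟩ := hP15₀
  -- (P2): Hecke's functional equation for `ψ^{2k+1}`, `ψ₀^{2k+1}`, transported to `φ`, `φ₀`
  have hw : ∃ w : ℂ, IsCentralRootNumberWt (φ ^ (2 * 7 ^ m + 1)) (7 ^ m) w := by
    obtain ⟨w, -, hw⟩ := exists_isCentralRootNumberWt_pow hHecke hK hinf heq (7 ^ m)
    rcases hφcase with h | h
    · exact ⟨w, h ▸ hw⟩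
    · exact ⟨w, h ▸ (isCentralRootNumberWt_galConj_pow_iff cK ψ _ _ w).2 hw⟩
  have hw₀ : ∃ w : ℂ, IsCentralRootNumberWt (φ₀ ^ (2 * 7 ^ m + 1)) (7 ^ m) w := by
    obtain ⟨w, -, hw⟩ := exists_isCentralRootNumberWt_pow hHecke hK hinf₀ heq₀ (7 ^ m)
    rcases hφ₀case with h | h
    · exact ⟨w, h ▸ hw⟩
    · exact ⟨w, h ▸ (isCentralRootNumberWt_galConj_pow_iff cK ψ₀ _ _ w).2 hw⟩
  obtain ⟨w, hw⟩ := hw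
  obtain ⟨w₀, hw₀⟩ := hw₀
  have hsgn := RubinPackageReduction.isCentralRootNumberWt_interpolated_one_of_xi hξ hξ₀ hw hw₀ hρ hr0
  -- (P3): at `𝔭` by FILE 2 (equivariance), away from `𝔭` by FILE 1 (twist transport) — NO H_QR
  exact ⟨cK, R, Ω₀, 𝓔₀, D₀', R₀, hξ, hξ₀, hsgn.1, hsgn.2,
    interpolated_not_isUnramifiedAt hDe hK hdK h7 cK hcK W hWcm hj ψ hinf heq hψ hφcase hφ hξ m,
    interpolated_not_isUnramifiedAt hDe hK hdK h7 cK hcK W₀ hW₀cm hW₀j' ψ₀ hinf₀ heq₀ hψ₀ hφ₀case hφ₀ hξ₀ m,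
    hΩ₀, hu, hu₀, hbase, hper, hbottom⟩

end Assembly

/-! ## §4 On 𝒞₇: S_pkg, S_open and the crux-level record with Deuring-with-GENERATORS -/

section ClassCSeven

variable {W : WeierstrassCurve ℚ} [W.IsElliptic] [W.IsGloballyMinimal]

/-- **S_pkg ⟸ Hecke-FE ∧ Deuring-G ∧ S_pkg⁻ at a member of 𝒞₇, every `D₀ ≠ 0` — NO UNIT VALUES, NO GROSS**
(H_Rig⁰ is the tree theorem `pinnedCharacterRigidityAtZp`). CONDITIONAL; nothing about BSD.
[cite: BurungaleKobayashiNakamuraOta2026, Def. 4.7, Thm. 4.12 and Thm. 7.2 (arXiv:2608.06879 pp. 27, 32, 41) (claim; preprint; shape only)]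
[cite: deShalit1987, II.1.1 (1)–(3)] [cite: SilvermanATAEC1994, Ch. II Thm. 9.2, Prop. 10.4, Thm. 10.5] -/
theorem rubinPackageAtZp_seven_of_hecke_of_deuringGenerators_of_reduced [Fact (Nat.Prime 7)] {D₀ : ℤ}
    (hD₀ : D₀ ≠ 0) (hHecke : Hecke_functionalEquation_infinityType)
    (hD : Deuring_exists_heckeCharacter_of_maximalCM_withGenerators) (hC : ClassCSeven W)
    (hred : RamifiedCMRubinPackageReducedAtZp W 7 D₀) : RamifiedCMRubinPackageAtZp W 7 D₀ :=
  rubinPackage_of_hecke_of_deuringGenerators_of_rigidity_of_reduced hC.2.1 hD₀ hHecke hD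
    (pinnedCharacterRigidityAtZp W 7) hred

/-- **S_open at a member ⟸ Hecke-FE ∧ Deuring-G ∧ S_pkg⁻ ∧ S_arch (base `D₀ = −11`) — NO UNIT VALUES.**
[cite: BurungaleKobayashiNakamuraOta2026, §1.4 (arXiv:2608.06879 p. 8) (the deferred value formula; shape only)] -/
theorem rubinFormulaAtZp_seven_of_hecke_of_deuringGenerators_of_reduced_of_archimedean [Fact (Nat.Prime 7)]
    (hHecke : Hecke_functionalEquation_infinityType)
    (hD : Deuring_exists_heckeCharacter_of_maximalCM_withGenerators) (hC : ClassCSeven W)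
    (hred : RamifiedCMRubinPackageReducedAtZp W 7 (-11))
    (harch : RamifiedCMArchimedeanValuationAtZp W 7 (-11)) : RamifiedCMRubinFormulaAtZp W 7 :=
  ramifiedCMRubinFormulaAtZp_of_relativeValuation_of_archimedean
    (RelativeValuationOfPackage.ramifiedCMRelativeValuationAtZp_of_package
      (rubinPackageAtZp_seven_of_hecke_of_deuringGenerators_of_reduced (by norm_num) hHecke hD hC hred)) harch

end ClassCSeven

end RubinPackageOfTwist

end Summit.BirchSwinnertonDyer.BirchSwinnertonDyer.Theorems.RamifiedSevenEllipticUnits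

end
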